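import Literature.Analysis.FluidPDE.HardSphereBoundaryFlux
import Literature.Analysis.FluidPDE.HardSphereFlowRegular
import Literature.Analysis.FluidPDE.HardSphereFreeStretch
import HarnessLib

/-!
# Almost every outgoing contact configuration of hard spheres on `T^d` is a regular point of
# the flow (the flux form of Alexander's theorem)
(Cercignani–Illner–Pulvirenti 1994 App. 4.A pp. 107–111 (the boundary map of the special flow
is defined almost everywhere for the flux measure `|v · n| dσ`); Gallagher–Saint-Raymond–Texier
2013 Prop. 4.1.1; Bodineau–Gallagher–Saint-Raymond 2016 p. 15 "one can check that `Ψ_{i+1}` is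
well defined up to a set of measure `0` [Simonella 2014]"; trunk T-KINETIC, topic
Analysis/FluidPDE (hard-sphere dynamics); layer B2c of the plan towards the inputs (S), (R), (Reg)
of `bodineau_gallagher_saintRaymond_linear_of_inputs` / `bgsr_linearBoltzmannApprox_of_inputs`.)

Alexander's theorem (`Alexander.torusFlow_ae_good_holds`) says that Lebesgue-almost every
configuration of the hard-sphere domain is a good point of the flow (`Alexander.good`). The
collision integrals of the BBGKY hierarchy, however, read functions at CONTACT configurations
(a Lebesgue-null set): a sphere adjoined at `x_i + ε ν` with velocity `w` to a configuration
`Z'` (`lossConfig`), parametrised by `(Z', w, ν)` with the flux measure. This file PROVES the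
flux form of Alexander's theorem consumed by the regularity input (Reg):

* `Alexander.mem_good_of_freeFlight_mem_good` — **badness persists along a collision-free free
  flight**: if the free flight issued from `W` meets no pair at distance `ε` during `(0, τ]` and
  `S_τ W` is good, then `W` is good (group law on the good set and `HardSphereFreeStretch`);
* `exists_forward_window` — an outgoing configuration of the closed hard-sphere domain all of
  whose contacts are outgoing flies freely, with all pairs at distance `> ε`, during a short time;
* `toSphere_setOf_inner_eq_eq_zero` — hyperplane sections `{ν | ⟪b, ν⟫ = c}` (`c ≠ 0`) of the
  unit sphere are null for the surface measure (the cone over them lies in the zero set of a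
  genuine quadratic along every line orthogonal to `b`, `volume_eq_zero_of_line_sections`);
* `toSphere_setOf_extraContact_eq_zero` — for a configuration `Z'` of the hard-sphere domain and
  `j ≠ i`, the impact directions `ν` for which the sphere adjoined at `x_i + εν` also touches
  sphere `j` form a null set (a countable union of hyperplane sections, one for each lattice
  translate);
* `ae_lossConfig_of_persistent` — the abstract engine: a property of `(s+1)`-configurations
  whose failure persists, along collision-free free flights, into a fixed Lebesgue-null set holds
  for flux-almost every outgoing adjoined configuration of the hard-sphere domain;
* `ae_lossConfig_mem_good` — **the flux form of Alexander's theorem**: for almost every `Z'`,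
  almost every `w` and `σ`-almost every `ν` with `⟪w - v_i, ν⟫ > 0` (outgoing), if the adjoined
  configuration `lossConfig Z' i ν w` lies in the hard-sphere domain then it is a good point of
  the `(s+1)`-sphere flow. Proof: by persistence, a bad outgoing single-contact configuration
  stays bad (and in the domain, inside the chart) along its free flight for a short time, so the
  bad parameters times a time interval are mapped into the Lebesgue-null pathological set, which
  `ae_not_mem_of_boundaryFlux_null_contact` (`HardSphereBoundaryFlux`) forbids outside a
  flux-null set; extra contacts are null by the previous item.

## References

* C. Cercignani, R. Illner, M. Pulvirenti, *The Mathematical Theory of Dilute Gases*, Springer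
  (1994), App. 4.A pp. 107–111.
* I. Gallagher, L. Saint-Raymond, B. Texier, *From Newton to Boltzmann*, EMS (2013),
  arXiv:1208.5753, Prop. 4.1.1.
* T. Bodineau, I. Gallagher, L. Saint-Raymond, Invent. Math. 203 (2016), arXiv:1305.3397v2, §5.1
  p. 15.
-/

open MeasureTheory MeasureTheory.Measure Metric Real Set Filter Function Module
open scoped ENNReal InnerProductSpace Topology Pointwise

namespace Literature.Analysis.FluidPDE

noncomputable section

section Kinetic

variable {d : Type*} [Fintype d]

/-! ## §1. Badness persists along a collision-free free flight -/

/-- **Goodness is inherited backwards along a collision-free free flight.** On `T^d`,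
`0 < ε < 1/2`: if the free flight issued from `W` has no pair at distance exactly `ε` at the
times `u ∈ (0, τ]` and `S_τ W` is a good point of the hard-sphere flow, then `W` is good
(`W` itself may be a contact configuration): the backward orbit of the good point `S_τ W` is
its backward free flight down to `W` (`HardSphereFlow.flow_neg_eq_freeFlight_of_freeFlight_ne`),
and the good set is invariant under the flow. Contrapositive: a bad configuration stays bad
along its outgoing free flight. [cite: GST2013, Prop. 4.1.1] -/
theorem Alexander.mem_good_of_freeFlight_mem_good {ε : ℝ} (hε : 0 < ε) (hε' : ε < 2⁻¹) {N : ℕ}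
    {W : Config N d (UnitAddTorus d)} {τ : ℝ} (hτ : 0 ≤ τ)
    (hfree : ∀ u ∈ Ioc 0 τ, ∀ i j : Fin N, i ≠ j →
      ‖(Torus.geometry d).sepVec (freeFlight (Torus.geometry d) u W i).1 (freeFlight (Torus.geometry d) u W j).1‖ ≠ ε)
    (hgood : freeFlight (Torus.geometry d) τ W ∈ Alexander.good (N := N) (Torus.geometry d) ε) :
    W ∈ Alexander.good (N := N) (Torus.geometry d) ε := by
  set Φ := Alexander.regHardSphereFlow (d := d) hε hε' N with hΦ
  have hz : freeFlight (Torus.geometry d) τ W ∈ Φ.good := hgood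
  have key := Φ.flow_neg_eq_freeFlight_of_freeFlight_ne hz (t := τ) (fun u hu i j hij => by
    rw [← freeFlight_add]
    exact hfree (-u + τ) ⟨by linarith [hu.2], by linarith [hu.1]⟩ i j hij) τ ⟨hτ, le_rfl⟩
  rw [← freeFlight_add, neg_add_cancel, freeFlight_zero] at key
  have hmaps := Φ.mapsTo_good (-τ) hz
  rw [key] at hmaps
  exact hmaps

/-! ## §2. The forward window of an outgoing configuration -/

/-- Along free flight on `T^d` the minimal-image distance of a pair is Lipschitz in time with
constant `‖v_i‖ + ‖v_j‖`. [folklore] -/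
theorem abs_norm_sepVec_freeFlight_sub_le {N : ℕ} (W : Config N d (UnitAddTorus d)) (i j : Fin N) (u : ℝ) :
    |‖(Torus.geometry d).sepVec (freeFlight (Torus.geometry d) u W i).1 (freeFlight (Torus.geometry d) u W j).1‖ -
        ‖(Torus.geometry d).sepVec (W i).1 (W j).1‖| ≤ |u| * (‖(W i).2‖ + ‖(W j).2‖) := by
  simp only [freeFlight_apply, Torus.geometry_translate, Torus.norm_geometry_sepVec]
  have h1 := Torus.euclidDist_translate_le (W i).1 (W j).1 (u • (W i).2) (u • (W j).2)
  have h2 := Torus.euclidDist_le_euclidDist_translate (W i).1 (W j).1 (u • (W i).2) (u • (W j).2)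
  have h3 : ‖u • (W i).2 - u • (W j).2‖ ≤ |u| * (‖(W i).2‖ + ‖(W j).2‖) := by
    calc ‖u • (W i).2 - u • (W j).2‖ ≤ ‖u • (W i).2‖ + ‖u • (W j).2‖ := norm_sub_le _ _
      _ = |u| * (‖(W i).2‖ + ‖(W j).2‖) := by rw [norm_smul, norm_smul, Real.norm_eq_abs]; ring
  rw [abs_le]
  constructor <;> linarith

/-- **An outgoing contact separates**: if `‖sep(x_i, x_j)‖ = ε < 1/2` and
`⟪sep(x_i, x_j), v_i - v_j⟫ > 0`, then for all sufficiently small `u > 0` the pair of free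
flights is at distance `> ε` (chart additivity of the minimal image and
`‖sep + u(v_i - v_j)‖² = ε² + 2u⟪sep, v_i - v_j⟫ + u²‖v_i - v_j‖² > ε²`). [folklore] -/
theorem exists_window_of_outgoing {ε : ℝ} (hε : 0 < ε) (hε' : ε < 2⁻¹) {N : ℕ} (W : Config N d (UnitAddTorus d))
    {i j : Fin N} (hdist : ‖(Torus.geometry d).sepVec (W i).1 (W j).1‖ = ε)
    (hout : 0 < ⟪(Torus.geometry d).sepVec (W i).1 (W j).1, (W i).2 - (W j).2⟫_ℝ) :
    ∃ τ₁ : ℝ, 0 < τ₁ ∧ ∀ u ∈ Ioc 0 τ₁,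
      ε < ‖(Torus.geometry d).sepVec (freeFlight (Torus.geometry d) u W i).1 (freeFlight (Torus.geometry d) u W j).1‖ := by
  set Δ : EuclideanSpace ℝ d := (W i).2 - (W j).2 with hΔ
  set σ₀ : EuclideanSpace ℝ d := (Torus.geometry d).sepVec (W i).1 (W j).1 with hσ₀
  have hgap : 0 < 2⁻¹ - ε := by linarith
  refine ⟨(2⁻¹ - ε) / (2 * (‖Δ‖ + 1)), by positivity, fun u hu => ?_⟩
  have hu0 : 0 < u := hu.1
  have huΔ : u * ‖Δ‖ < 2⁻¹ - ε := by
    have h1 : u * ‖Δ‖ ≤ (2⁻¹ - ε) / (2 * (‖Δ‖ + 1)) * ‖Δ‖ := mul_le_mul_of_nonneg_right hu.2 (norm_nonneg _)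
    have h2 : (2⁻¹ - ε) / (2 * (‖Δ‖ + 1)) * ‖Δ‖ < 2⁻¹ - ε := by
      rw [div_mul_eq_mul_div, div_lt_iff₀ (by positivity)]
      nlinarith [norm_nonneg Δ]
    linarith
  -- chart additivity
  have hchart : ‖σ₀‖ + ‖u • (W i).2 - u • (W j).2‖ < 1 / 2 := by
    rw [← smul_sub, norm_smul, Real.norm_of_nonneg hu0.le, hσ₀, hdist]
    linarith
  have hsep : (Torus.geometry d).sepVec (freeFlight (Torus.geometry d) u W i).1 (freeFlight (Torus.geometry d) u W j).1 =
      σ₀ + u • Δ := by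
    simp only [freeFlight_apply]
    rw [Torus.sepVec_translate_of_norm_lt hchart, ← smul_sub]
  rw [hsep]
  have hsq : ‖σ₀ + u • Δ‖ ^ 2 = ε ^ 2 + 2 * u * ⟪σ₀, Δ⟫_ℝ + u ^ 2 * ‖Δ‖ ^ 2 := by
    rw [norm_add_sq_real, norm_smul, real_inner_smul_right, Real.norm_of_nonneg hu0.le, hσ₀, hdist]
    ring
  have hgt : ε ^ 2 < ‖σ₀ + u • Δ‖ ^ 2 := by
    rw [hsq]
    have : 0 < 2 * u * ⟪σ₀, Δ⟫_ℝ := by positivity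
    nlinarith [sq_nonneg (u * ‖Δ‖)]
  exact lt_of_pow_lt_pow_left₀ 2 (norm_nonneg _) hgt

/-- **The forward window of an outgoing configuration**: a configuration all of whose pairs are
at distance `≥ ε` and whose pairs at distance exactly `ε` are outgoing flies freely, with all
pairs at distance `> ε`, during `(0, τ₁]` for some `τ₁ > 0` (finitely many pairs; separated
pairs by continuity, contact pairs by `exists_window_of_outgoing`). [folklore] -/
theorem exists_forward_window {ε : ℝ} (hε : 0 < ε) (hε' : ε < 2⁻¹) {N : ℕ} (W : Config N d (UnitAddTorus d))
    (hD : ∀ i j : Fin N, i ≠ j → ε ≤ ‖(Torus.geometry d).sepVec (W i).1 (W j).1‖)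
    (hout : ∀ i j : Fin N, i ≠ j → ‖(Torus.geometry d).sepVec (W i).1 (W j).1‖ = ε →
      0 < ⟪(Torus.geometry d).sepVec (W i).1 (W j).1, (W i).2 - (W j).2⟫_ℝ) :
    ∃ τ₁ : ℝ, 0 < τ₁ ∧ ∀ u ∈ Ioc 0 τ₁, ∀ i j : Fin N, i ≠ j →
      ε < ‖(Torus.geometry d).sepVec (freeFlight (Torus.geometry d) u W i).1 (freeFlight (Torus.geometry d) u W j).1‖ := by
  classical
  -- a window for each ordered pair
  have hpair : ∀ p : Fin N × Fin N, ∃ τp : ℝ, 0 < τp ∧ (p.1 ≠ p.2 → ∀ u ∈ Ioc 0 τp,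
      ε < ‖(Torus.geometry d).sepVec (freeFlight (Torus.geometry d) u W p.1).1 (freeFlight (Torus.geometry d) u W p.2).1‖) := by
    rintro ⟨i, j⟩
    by_cases hij : i = j
    · exact ⟨1, one_pos, fun h => absurd hij h⟩
    rcases (hD i j hij).eq_or_lt with heq | hlt
    · obtain ⟨τ₁, hτ₁, h⟩ := exists_window_of_outgoing hε hε' W heq.symm (hout i j hij heq.symm)
      exact ⟨τ₁, hτ₁, fun _ => h⟩
    · -- separated pair: Lipschitz continuity
      set gap := ‖(Torus.geometry d).sepVec (W i).1 (W j).1‖ - ε with hgap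
      have hgap0 : 0 < gap := by rw [hgap]; linarith
      set L := ‖(W i).2‖ + ‖(W j).2‖ with hL
      refine ⟨gap / (2 * (L + 1)), by positivity, fun _ u hu => ?_⟩
      have hlip := abs_norm_sepVec_freeFlight_sub_le W i j u
      rw [abs_of_pos hu.1] at hlip
      have huL : u * L < gap := by
        have h1 : u * L ≤ gap / (2 * (L + 1)) * L := mul_le_mul_of_nonneg_right hu.2 (by positivity)
        have h2 : gap / (2 * (L + 1)) * L < gap := by
          rw [div_mul_eq_mul_div, div_lt_iff₀ (by positivity)]
          nlinarith [show 0 ≤ L by positivity]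
        linarith
      rw [abs_le] at hlip
      linarith [hlip.1]
  choose τp hτp hwin using hpair
  by_cases hN : N = 0
  · subst hN
    exact ⟨1, one_pos, fun u _ i => Fin.elim0 i⟩
  have hne : (Finset.univ : Finset (Fin N × Fin N)).Nonempty := by
    obtain ⟨n, rfl⟩ : ∃ n, N = n + 1 := Nat.exists_eq_succ_of_ne_zero hN
    exact ⟨(0, 0), Finset.mem_univ _⟩
  refine ⟨Finset.univ.inf' hne τp, (Finset.lt_inf'_iff hne).2 fun p _ => hτp p, fun u hu i j hij => ?_⟩
  have hle : Finset.univ.inf' hne τp ≤ τp (i, j) := Finset.inf'_le _ (Finset.mem_univ _)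
  exact hwin (i, j) hij u ⟨hu.1, hu.2.trans hle⟩

/-! ## §3. Hyperplane sections of the sphere are null -/

/-- **A hyperplane section `{ν | ⟪b, ν⟫ = c}` of the unit sphere (`c ≠ 0`) is null for the
surface measure** (`d ≥ 2`). By `toSphere_apply'` its surface measure is `d` times the Lebesgue
measure of the cone `{y | 0 < ‖y‖ < 1, ⟪b, y⟫ = c ‖y‖}`, which lies in the zero set of the
quadratic form `⟪b, y⟫² - c² ‖y‖²`; along every line in a direction `e ⊥ b`, `e ≠ 0`, this is a
genuine quadratic in the line parameter (leading coefficient `-c²‖e‖²`), hence the zero set is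
Lebesgue-null (`volume_eq_zero_of_line_sections`). [folklore] -/
theorem toSphere_setOf_inner_eq_eq_zero (hd : 2 ≤ Fintype.card d) (b : EuclideanSpace ℝ d) {c : ℝ} (hc : c ≠ 0) :
    (volume : Measure (EuclideanSpace ℝ d)).toSphere {ν : sphere (0 : EuclideanSpace ℝ d) 1 | ⟪b, (ν : EuclideanSpace ℝ d)⟫_ℝ = c} = 0 := by
  -- a nonzero vector orthogonal to `b`
  obtain ⟨e, heb, he⟩ : ∃ e : EuclideanSpace ℝ d, ⟪b, e⟫_ℝ = 0 ∧ e ≠ 0 := by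
    haveI : Nontrivial (EuclideanSpace ℝ d) := by
      have : 0 < finrank ℝ (EuclideanSpace ℝ d) := by rw [finrank_euclideanSpace]; omega
      exact Module.finrank_pos_iff.1 this
    by_cases hb : b = 0
    · obtain ⟨e, he⟩ := exists_ne (0 : EuclideanSpace ℝ d)
      exact ⟨e, by simp [hb], he⟩
    · have hK : finrank ℝ (ℝ ∙ b)ᗮ = Fintype.card d - 1 := by
        have h1 := Submodule.finrank_add_finrank_orthogonal (ℝ ∙ b)
        rw [finrank_span_singleton hb, finrank_euclideanSpace] at h1
        omega
      have hne : (ℝ ∙ b)ᗮ ≠ ⊥ := fun h => by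
        rw [h, finrank_bot] at hK
        omega
      obtain ⟨e, heK, he⟩ := (Submodule.ne_bot_iff _).1 hne
      exact ⟨e, (Submodule.mem_orthogonal_singleton_iff_inner_right).1 heK, he⟩
  -- the section is measurable
  have hmeasA : MeasurableSet {ν : sphere (0 : EuclideanSpace ℝ d) 1 | ⟪b, (ν : EuclideanSpace ℝ d)⟫_ℝ = c} :=
    measurableSet_eq_fun ((continuous_const.inner continuous_subtype_val).measurable) measurable_const
  rw [toSphere_apply' _ hmeasA]
  suffices h : volume (Ioo (0 : ℝ) 1 • (Subtype.val '' {ν : sphere (0 : EuclideanSpace ℝ d) 1 |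
      ⟪b, (ν : EuclideanSpace ℝ d)⟫_ℝ = c})) = 0 by
    rw [h, mul_zero]
  -- the cone lies in the zero set of the quadratic form `⟪b, y⟫² - c² ‖y‖²`
  set Z : Set (EuclideanSpace ℝ d) := {y | ⟪b, y⟫_ℝ ^ 2 - c ^ 2 * ‖y‖ ^ 2 = 0} with hZ
  have hZm : MeasurableSet Z := by
    rw [hZ]
    exact measurableSet_eq_fun (by fun_prop) measurable_const
  refine measure_mono_null ?_ (volume_eq_zero_of_line_sections hZm e fun u => ?_)
  · rintro y hy
    rw [Set.mem_smul] at hy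
    obtain ⟨r, hr, x, ⟨ν, hν, rfl⟩, rfl⟩ := hy
    have hνn : ‖(ν : EuclideanSpace ℝ d)‖ = 1 := by simp
    have hνc : ⟪b, (ν : EuclideanSpace ℝ d)⟫_ℝ = c := hν
    show ⟪b, r • (ν : EuclideanSpace ℝ d)⟫_ℝ ^ 2 - c ^ 2 * ‖r • (ν : EuclideanSpace ℝ d)‖ ^ 2 = 0
    rw [inner_smul_right, hνc, norm_smul, hνn, mul_one, Real.norm_eq_abs, sq_abs]
    ring
  · -- along the line `u + s e` the condition is a genuine quadratic in `s`
    have hline : {s : ℝ | u + s • e ∈ Z} =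
        {s : ℝ | (-(c ^ 2 * ‖e‖ ^ 2)) * (s * s) + (-(2 * c ^ 2 * ⟪u, e⟫_ℝ)) * s + (⟪b, u⟫_ℝ ^ 2 - c ^ 2 * ‖u‖ ^ 2) = 0} := by
      ext s
      simp only [hZ, mem_setOf_eq]
      have hx : ⟪b, u + s • e⟫_ℝ ^ 2 - c ^ 2 * ‖u + s • e‖ ^ 2 =
          (-(c ^ 2 * ‖e‖ ^ 2)) * (s * s) + (-(2 * c ^ 2 * ⟪u, e⟫_ℝ)) * s + (⟪b, u⟫_ℝ ^ 2 - c ^ 2 * ‖u‖ ^ 2) := by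
        rw [inner_add_right, inner_smul_right, heb, mul_zero, add_zero, norm_add_sq_real, inner_smul_right, norm_smul,
          mul_pow, Real.norm_eq_abs, sq_abs]
        ring
      rw [hx]
    rw [hline]
    have hlead : -(c ^ 2 * ‖e‖ ^ 2) ≠ 0 := by
      have h1 : 0 < ‖e‖ := norm_pos_iff.2 he
      have h2 : 0 < c ^ 2 * ‖e‖ ^ 2 := by positivity
      linarith
    exact volume_setOf_quadratic_eq_zero hlead

/-! ## §4. Extra contacts are null -/

/-- The minimal image of a point of the covering space differs from it by a lattice vector. [folklore] -/
theorem exists_reprSym_proj_eq_add_latticeVec [DecidableEq d] (a : EuclideanSpace ℝ d) :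
    ∃ k : d → ℤ, Torus.reprSym (FunctionSpaces.Torus.proj a) = a + FunctionSpaces.Torus.latticeVec k :=
  (FunctionSpaces.Torus.proj_eq_proj_iff_holds a (Torus.reprSym (FunctionSpaces.Torus.proj a))).1
    (Torus.proj_reprSym (FunctionSpaces.Torus.proj a)).symm

/-- **The impact directions producing an extra contact are null.** For two distinct points
`x ≠ y` of `T^d` (`d ≥ 2`) and `ε > 0`, the directions `ν ∈ S^{d-1}` for which the minimal-image
distance from `y` to `x + proj (ε ν)` is exactly `ε` form a null set for the surface measure:
writing `y - x = proj b`, the condition reads `‖b + k - ε ν‖ = ε` for some lattice vector `k`,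
i.e. `⟪b + k, ν⟫ = ‖b + k‖²/(2ε)` with `b + k ≠ 0` — a countable union of hyperplane sections
(`toSphere_setOf_inner_eq_eq_zero`). [folklore] -/
theorem toSphere_setOf_extraContact_eq_zero [DecidableEq d] (hd : 2 ≤ Fintype.card d) {ε : ℝ} (hε : 0 < ε)
    {x y : UnitAddTorus d} (hxy : x ≠ y) :
    (volume : Measure (EuclideanSpace ℝ d)).toSphere {ν : sphere (0 : EuclideanSpace ℝ d) 1 |
      Torus.euclidDist y (x + FunctionSpaces.Torus.proj (ε • (ν : EuclideanSpace ℝ d))) = ε} = 0 := by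
  set b : EuclideanSpace ℝ d := Torus.reprSym (y - x) with hb
  have hyx : y - x = FunctionSpaces.Torus.proj b := (Torus.proj_reprSym (y - x)).symm
  -- the countable family of hyperplane sections
  set H : (d → ℤ) → Set (sphere (0 : EuclideanSpace ℝ d) 1) := fun k =>
    {ν | ⟪b + FunctionSpaces.Torus.latticeVec k, (ν : EuclideanSpace ℝ d)⟫_ℝ =
      ‖b + FunctionSpaces.Torus.latticeVec k‖ ^ 2 / (2 * ε)} with hH
  have hsub : {ν : sphere (0 : EuclideanSpace ℝ d) 1 |
      Torus.euclidDist y (x + FunctionSpaces.Torus.proj (ε • (ν : EuclideanSpace ℝ d))) = ε} ⊆ ⋃ k, H k := by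
    intro ν hν
    have hνn : ‖(ν : EuclideanSpace ℝ d)‖ = 1 := by simp
    simp only [mem_setOf_eq] at hν
    -- `y - (x + proj (εν)) = proj (b - εν)`
    have hdiff : y - (x + FunctionSpaces.Torus.proj (ε • (ν : EuclideanSpace ℝ d))) =
        FunctionSpaces.Torus.proj (b - ε • (ν : EuclideanSpace ℝ d)) := by
      rw [show ∀ a c : EuclideanSpace ℝ d, FunctionSpaces.Torus.proj (a - c) =
        FunctionSpaces.Torus.proj a - FunctionSpaces.Torus.proj c from fun _ _ => rfl, ← hyx]
      abel
    obtain ⟨k, hk⟩ := exists_reprSym_proj_eq_add_latticeVec (b - ε • (ν : EuclideanSpace ℝ d))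
    have hnorm : ‖b + FunctionSpaces.Torus.latticeVec k - ε • (ν : EuclideanSpace ℝ d)‖ = ε := by
      unfold Torus.euclidDist at hν
      rw [hdiff, hk] at hν
      rwa [show b + FunctionSpaces.Torus.latticeVec k - ε • (ν : EuclideanSpace ℝ d) =
        b - ε • (ν : EuclideanSpace ℝ d) + FunctionSpaces.Torus.latticeVec k by abel]
    refine mem_iUnion.2 ⟨k, ?_⟩
    set a : EuclideanSpace ℝ d := b + FunctionSpaces.Torus.latticeVec k with ha
    show ⟪a, (ν : EuclideanSpace ℝ d)⟫_ℝ = ‖a‖ ^ 2 / (2 * ε)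
    have hsq : ‖a - ε • (ν : EuclideanSpace ℝ d)‖ ^ 2 = ε ^ 2 := by rw [hnorm]
    rw [norm_sub_sq_real, norm_smul, hνn, mul_one, Real.norm_of_nonneg hε.le, inner_smul_right] at hsq
    field_simp
    linarith
  refine measure_mono_null hsub (measure_iUnion_null fun k => ?_)
  -- each section is null: the vector `b + k` is nonzero since `x ≠ y`
  have hak : b + FunctionSpaces.Torus.latticeVec k ≠ 0 := by
    intro h0
    apply hxy
    have : FunctionSpaces.Torus.proj b = FunctionSpaces.Torus.proj (-(FunctionSpaces.Torus.latticeVec k)) := by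
      rw [eq_neg_of_add_eq_zero_left h0]
    rw [FunctionSpaces.Torus.proj_neg, FunctionSpaces.Torus.proj_latticeVec, neg_zero] at this
    rw [this] at hyx
    exact (sub_eq_zero.1 hyx).symm
  have hck : ‖b + FunctionSpaces.Torus.latticeVec k‖ ^ 2 / (2 * ε) ≠ 0 :=
    div_ne_zero (pow_ne_zero 2 (norm_ne_zero_iff.2 hak)) (by positivity)
  exact toSphere_setOf_inner_eq_eq_zero hd _ hck

/-! ## §5. The flux form of Alexander's theorem -/

section LossConfig

variable {X : Type*} {s : ℕ} (G : Geometry d X) (ε : ℝ) (Zs : Config s d X) (i : Fin s)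
  (ω v : EuclideanSpace ℝ d)

/-- If the adjoined configuration lies in the hard-sphere domain, so does the old one (the old
particles of `lossConfig` are those of `Zs`, `lossConfig_apply_castAdd` of the kinetic-theory
files). [folklore] -/
theorem mem_hardSphereDomain_of_lossConfig_mem
    (h : lossConfig G ε Zs i ω v ∈ hardSphereDomain G (s + 1) ε) : Zs ∈ hardSphereDomain G s ε := by
  intro j k hjk
  have := h (Fin.castAdd 1 j) (Fin.castAdd 1 k) (fun he => hjk (Fin.castAdd_injective _ _ he))
  simpa [lossConfig, appendParticle] using this

end LossConfig

/-- Volume of an open interval of positive length is nonzero. [folklore] -/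
theorem volume_Ioo_ne_zero {a b : ℝ} (h : a < b) : (volume : Measure ℝ) (Ioo a b) ≠ 0 := by
  rw [Real.volume_Ioo]
  exact (ENNReal.ofReal_pos.2 (by linarith)).ne'

/-- **Persistent badness is flux-negligible** (the abstract engine of the flux form of
Alexander's theorem). Let `T ⊆ Config (s + 1)` be a Lebesgue-null measurable set and `P` a
property of `(s+1)`-configurations which *persists into `T`*: whenever a configuration `W₀`
violates `P` and its free flight keeps all pairs at distance `> ε` during `(0, τ]` (`0 < τ ≤ 1`),
the configuration `S_τ W₀` lies in `T`. Then for almost every `Z'`, almost every `w` and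
`σ`-almost every outgoing direction `ν` (`⟪w - v_i, ν⟫ > 0`), the adjoined configuration
`lossConfig Z' i ν w`, if it lies in the hard-sphere domain, satisfies `P`. Proof: a bad outgoing
direction whose adjoined configuration has no extra contact has a forward window
(`exists_forward_window`) and stays in the chart for a while, so the bad directions are covered
by the extra-contact null set (`toSphere_setOf_extraContact_eq_zero`) and countably many sets
`A_m` whose products with the time interval `(0, 1/(m+1))` are mapped into `T`, hence are null by
`ae_not_mem_of_boundaryFlux_null_contact`. [cite: CIP1994, App. 4.A pp. 108–111] -/
theorem ae_lossConfig_of_persistent [DecidableEq d] (hd : 2 ≤ Fintype.card d) {ε : ℝ} (hε : 0 < ε) (hε' : ε < 2⁻¹)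
    {s : ℕ} (i : Fin s) {T : Set (Config (s + 1) d (UnitAddTorus d))} (hTm : MeasurableSet T) (hT0 : volume T = 0)
    (P : Config (s + 1) d (UnitAddTorus d) → Prop)
    (hpers : ∀ (W₀ : Config (s + 1) d (UnitAddTorus d)) (τ : ℝ), 0 < τ → τ ≤ 1 →
      (∀ u ∈ Ioc 0 τ, ∀ j k : Fin (s + 1), j ≠ k →
        ε < ‖(Torus.geometry d).sepVec (freeFlight (Torus.geometry d) u W₀ j).1 (freeFlight (Torus.geometry d) u W₀ k).1‖) →
      ¬ P W₀ → freeFlight (Torus.geometry d) τ W₀ ∈ T) :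
    ∀ᵐ Z' : Config s d (UnitAddTorus d), ∀ᵐ w : EuclideanSpace ℝ d,
      ∀ᵐ ν : sphere (0 : EuclideanSpace ℝ d) 1 ∂(volume : Measure (EuclideanSpace ℝ d)).toSphere,
        0 < ⟪w - (Z' i).2, (ν : EuclideanSpace ℝ d)⟫_ℝ →
        lossConfig (Torus.geometry d) ε Z' i ν w ∈ hardSphereDomain (Torus.geometry d) (s + 1) ε →
        P (lossConfig (Torus.geometry d) ε Z' i ν w) := by
  classical
  haveI : Nonempty d := Fintype.card_pos_iff.1 (by omega)
  set G := Torus.geometry d with hG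
  -- the chart radius
  set ρ : ℝ := (ε + 2⁻¹) / 2 with hρ
  have hρ2 : ρ < 1 / 2 := by rw [hρ]; linarith
  have hερ : ε < ρ := by rw [hρ]; linarith
  -- the flux transport of the pathological set, in contact-time coordinates
  have H0 := ae_not_mem_of_boundaryFlux_null_contact (d := d) i hε hρ2 hTm hT0
  -- almost every old configuration has no pair at distance exactly `ε`
  have H1 : ∀ᵐ Z' : Config s d (UnitAddTorus d), ∀ j k : Fin s, j ≠ k → ‖G.sepVec (Z' j).1 (Z' k).1‖ ≠ ε := by
    refine ae_all_iff.2 fun j => ae_all_iff.2 fun k => ?_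
    by_cases hjk : j = k
    · exact ae_of_all _ fun Z' h => absurd hjk h
    · have h0 := volume_setOf_norm_sepVec_eq (d := d) (N := s) hε.ne' hjk
      rw [measure_eq_zero_iff_ae_notMem] at h0
      filter_upwards [h0] with Z' hZ' _
      exact hZ'
  filter_upwards [H0, H1] with Z' h0 h1
  filter_upwards [h0] with w hw
  -- reduce to old configurations in the hard-sphere domain
  by_cases hZD : Z' ∈ hardSphereDomain G s ε
  swap
  · exact ae_of_all _ fun ν _ hD => absurd (mem_hardSphereDomain_of_lossConfig_mem G ε Z' i _ _ hD) hZD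
  -- notation
  set u : EuclideanSpace ℝ d := w - (Z' i).2 with hu
  set W₀ : sphere (0 : EuclideanSpace ℝ d) 1 → Config (s + 1) d (UnitAddTorus d) :=
    fun ν => lossConfig G ε Z' i ν w with hW₀
  -- the extra-contact directions are null
  set Xset : Set (sphere (0 : EuclideanSpace ℝ d) 1) :=
    {ν | ∃ j : Fin s, j ≠ i ∧ Torus.euclidDist (Z' j).1 ((Z' i).1 + FunctionSpaces.Torus.proj (ε • (ν : EuclideanSpace ℝ d))) = ε}
    with hXset
  have hX0 : (volume : Measure (EuclideanSpace ℝ d)).toSphere Xset = 0 := by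
    have hsub : Xset ⊆ ⋃ j : Fin s, {ν : sphere (0 : EuclideanSpace ℝ d) 1 | j ≠ i ∧
        Torus.euclidDist (Z' j).1 ((Z' i).1 + FunctionSpaces.Torus.proj (ε • (ν : EuclideanSpace ℝ d))) = ε} := by
      intro ν hν
      obtain ⟨j, hj, h⟩ := hν
      exact mem_iUnion.2 ⟨j, hj, h⟩
    refine measure_mono_null hsub (measure_iUnion_null fun j => ?_)
    by_cases hji : j = i
    · have hempty : {ν : sphere (0 : EuclideanSpace ℝ d) 1 | j ≠ i ∧
          Torus.euclidDist (Z' j).1 ((Z' i).1 + FunctionSpaces.Torus.proj (ε • (ν : EuclideanSpace ℝ d))) = ε} = ∅ :=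
        Set.eq_empty_iff_forall_notMem.2 fun ν h => h.1 hji
      rw [hempty, measure_empty]
    · have hne : (Z' i).1 ≠ (Z' j).1 := by
        intro heq
        have hge := hZD i j (Ne.symm hji)
        rw [heq, hG] at hge
        simp only [Torus.geometry_sepVec, sub_self, Torus.reprSym_zero, norm_zero] at hge
        linarith
      refine measure_mono_null (fun ν hν => hν.2) ?_
      exact toSphere_setOf_extraContact_eq_zero hd hε hne
  -- the bad directions
  set Bad : Set (sphere (0 : EuclideanSpace ℝ d) 1) :=
    {ν | 0 < ⟪u, (ν : EuclideanSpace ℝ d)⟫_ℝ ∧ W₀ ν ∈ hardSphereDomain G (s + 1) ε ∧ ¬ P (W₀ ν)} with hBad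
  -- the approximating sets `A m`: bad, no extra contact, forward window and chart of length `1/(m+1)`
  set A : ℕ → Set (sphere (0 : EuclideanSpace ℝ d) 1) := fun m =>
    {ν | ν ∈ Bad ∧ (∀ τ ∈ Ioc (0 : ℝ) (1 / ((m : ℝ) + 1)), ∀ j k : Fin (s + 1), j ≠ k →
        ε < ‖G.sepVec (freeFlight G τ (W₀ ν) j).1 (freeFlight G τ (W₀ ν) k).1‖) ∧
      (∀ τ ∈ Ioc (0 : ℝ) (1 / ((m : ℝ) + 1)), ε • (ν : EuclideanSpace ℝ d) + τ • u ∈ closedBall (0 : EuclideanSpace ℝ d) ρ)}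
    with hA
  -- (i) each `A m` is null
  have hA0 : ∀ m : ℕ, (volume : Measure (EuclideanSpace ℝ d)).toSphere (A m) = 0 := by
    intro m
    have hm : (0 : ℝ) < 1 / ((m : ℝ) + 1) := Nat.one_div_pos_of_nat
    -- the rectangle `A m × (0, 1/(m+1))` lies in the null set of `hw`
    have hrect : A m ×ˢ Ioo (0 : ℝ) (1 / ((m : ℝ) + 1)) ⊆
        {q : sphere (0 : EuclideanSpace ℝ d) 1 × ℝ | 0 < ⟪w - (Z' i).2, (q.1 : EuclideanSpace ℝ d)⟫_ℝ ∧ 0 < q.2 ∧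
          ε • (q.1 : EuclideanSpace ℝ d) + q.2 • (w - (Z' i).2) ∈ closedBall (0 : EuclideanSpace ℝ d) ρ ∧
          freeFlight G q.2 (lossConfig G ε Z' i q.1 w) ∈ T} := by
      rintro ⟨ν, τ⟩ ⟨⟨hνB, hwin, hch⟩, hτ⟩
      simp only [mem_Ioo] at hτ
      have hτI : τ ∈ Ioc (0 : ℝ) (1 / ((m : ℝ) + 1)) := ⟨hτ.1, hτ.2.le⟩
      refine ⟨hνB.1, hτ.1, hch τ hτI, ?_⟩
      -- persistence into `T`
      have hτ1 : τ ≤ 1 := by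
        have h1 : 1 / ((m : ℝ) + 1) ≤ 1 := by
          rw [div_le_one (by positivity)]
          linarith [(Nat.cast_nonneg m : (0 : ℝ) ≤ m)]
        exact hτ.2.le.trans h1
      exact hpers (W₀ ν) τ hτ.1 hτ1 (fun u' hu' j k hjk => hwin u' ⟨hu'.1, hu'.2.trans hτ.2.le⟩ j k hjk) hνB.2.2
    have hnull : ((volume : Measure (EuclideanSpace ℝ d)).toSphere.prod (volume : Measure ℝ))
        (A m ×ˢ Ioo (0 : ℝ) (1 / ((m : ℝ) + 1))) = 0 := by
      refine measure_mono_null hrect ?_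
      rw [measure_eq_zero_iff_ae_notMem]
      filter_upwards [hw] with q hq hq'
      exact hq hq'
    rw [Measure.prod_prod, mul_eq_zero] at hnull
    exact hnull.resolve_right (volume_Ioo_ne_zero hm)
  -- (ii) `Bad ⊆ Xset ∪ ⋃ m, A m`
  have hcover : Bad ⊆ Xset ∪ ⋃ m, A m := by
    intro ν hνB
    by_cases hνX : ν ∈ Xset
    · exact Or.inl hνX
    refine Or.inr (mem_iUnion.2 ?_)
    have hνn : ‖(ν : EuclideanSpace ℝ d)‖ = 1 := by simp
    have hout : 0 < ⟪u, (ν : EuclideanSpace ℝ d)⟫_ℝ := hνB.1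
    have hWD : W₀ ν ∈ hardSphereDomain G (s + 1) ε := hνB.2.1
    -- the separation vectors of the new pair
    have hε2 : ε < 1 / 2 := lt_of_lt_of_eq hε' (by norm_num)
    have hεν : ε • (ν : EuclideanSpace ℝ d) ∈ Torus.symCube d := by
      refine Torus.closedBall_subset_symCube hε2 ?_
      rw [mem_closedBall, dist_zero_right, norm_smul, hνn, mul_one, Real.norm_of_nonneg hε.le]
    have hεν' : -(ε • (ν : EuclideanSpace ℝ d)) ∈ Torus.symCube d := by
      refine Torus.closedBall_subset_symCube hε2 ?_
      rw [mem_closedBall, dist_zero_right, norm_neg, norm_smul, hνn, mul_one, Real.norm_of_nonneg hε.le]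
    have hlast : W₀ ν (Fin.natAdd s 0) = ((Z' i).1 + FunctionSpaces.Torus.proj (ε • (ν : EuclideanSpace ℝ d)), w) := by
      rw [hW₀]; simp [lossConfig, appendParticle, hG]
    have hold : ∀ j : Fin s, W₀ ν (Fin.castAdd 1 j) = Z' j := fun j => by
      rw [hW₀]; simp [lossConfig, appendParticle]
    have hsep_il : G.sepVec (W₀ ν (Fin.castAdd 1 i)).1 (W₀ ν (Fin.natAdd s 0)).1 = -(ε • (ν : EuclideanSpace ℝ d)) := by
      rw [hold, hlast, hG, Torus.geometry_sepVec]
      rw [show (Z' i).1 - ((Z' i).1 + FunctionSpaces.Torus.proj (ε • (ν : EuclideanSpace ℝ d))) =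
        FunctionSpaces.Torus.proj (-(ε • (ν : EuclideanSpace ℝ d))) by rw [FunctionSpaces.Torus.proj_neg]; abel]
      exact Alexander.reprSym_proj_of_mem_symCube hεν'
    have hsep_li : G.sepVec (W₀ ν (Fin.natAdd s 0)).1 (W₀ ν (Fin.castAdd 1 i)).1 = ε • (ν : EuclideanSpace ℝ d) := by
      rw [hold, hlast, hG, Torus.geometry_sepVec, add_sub_cancel_left]
      exact Alexander.reprSym_proj_of_mem_symCube hεν
    -- classification of the pairs at distance exactly `ε`: only the new pair
    have hpairs : ∀ j k : Fin (s + 1), j ≠ k → ‖G.sepVec (W₀ ν j).1 (W₀ ν k).1‖ = ε →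
        0 < ⟪G.sepVec (W₀ ν j).1 (W₀ ν k).1, (W₀ ν j).2 - (W₀ ν k).2⟫_ℝ := by
      intro j k
      induction j using Fin.addCases with
      | left j' =>
        induction k using Fin.addCases with
        | left k' =>
          -- old–old: no contact
          intro hjk hcontact
          exfalso
          rw [hold, hold] at hcontact
          by_cases hjk' : j' = k'
          · exact hjk (by rw [hjk'])
          · exact h1 j' k' hjk' hcontact
        | right k' =>
          -- old–new
          obtain rfl : k' = 0 := Subsingleton.elim _ _
          intro _ hcontact
          by_cases hj'i : j' = i
          · subst hj'i
            rw [hsep_il, hold, hlast]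
            have : ⟪-(ε • (ν : EuclideanSpace ℝ d)), (Z' j').2 - w⟫_ℝ = ε * ⟪u, (ν : EuclideanSpace ℝ d)⟫_ℝ := by
              rw [hu, inner_neg_left, inner_smul_left, real_inner_comm]
              simp only [RCLike.conj_to_real, inner_sub_left]
              ring
            rw [this]
            exact mul_pos hε hout
          · exfalso
            apply hνX
            refine ⟨j', hj'i, ?_⟩
            rw [hold, hlast, hG, Torus.norm_geometry_sepVec] at hcontact
            exact hcontact
      | right j' =>
        induction k using Fin.addCases with
        | left k' =>
          -- new–old
          obtain rfl : j' = 0 := Subsingleton.elim _ _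
          intro _ hcontact
          by_cases hk'i : k' = i
          · subst hk'i
            rw [hsep_li, hold, hlast]
            have : ⟪ε • (ν : EuclideanSpace ℝ d), w - (Z' k').2⟫_ℝ = ε * ⟪u, (ν : EuclideanSpace ℝ d)⟫_ℝ := by
              rw [hu, inner_smul_left, real_inner_comm]
              simp only [RCLike.conj_to_real]
            rw [this]
            exact mul_pos hε hout
          · exfalso
            apply hνX
            refine ⟨k', hk'i, ?_⟩
            rw [hold, hlast, hG, Torus.norm_geometry_sepVec, Torus.euclidDist_comm] at hcontact
            exact hcontact
        | right k' =>
          -- new–new: impossible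
          obtain rfl : j' = 0 := Subsingleton.elim _ _
          obtain rfl : k' = 0 := Subsingleton.elim _ _
          intro hjk
          exact absurd rfl hjk
    obtain ⟨τ₁, hτ₁, hwin⟩ := exists_forward_window hε hε' (W₀ ν) (fun j k hjk => hWD j k hjk) hpairs
    -- the chart time
    set τ₂ : ℝ := (ρ - ε) / (‖u‖ + 1) with hτ₂
    have hτ₂0 : 0 < τ₂ := by rw [hτ₂]; exact div_pos (by linarith) (by positivity)
    obtain ⟨m, hm⟩ := exists_nat_one_div_lt (lt_min hτ₁ hτ₂0)
    refine ⟨m, hνB, fun τ hτ j k hjk => hwin τ ⟨hτ.1, hτ.2.trans ((le_of_lt hm).trans (min_le_left _ _))⟩ j k hjk,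
      fun τ hτ => ?_⟩
    have hτle : τ ≤ τ₂ := hτ.2.trans ((le_of_lt hm).trans (min_le_right _ _))
    rw [mem_closedBall, dist_zero_right]
    calc ‖ε • (ν : EuclideanSpace ℝ d) + τ • u‖ ≤ ‖ε • (ν : EuclideanSpace ℝ d)‖ + ‖τ • u‖ := norm_add_le _ _
      _ = ε + τ * ‖u‖ := by
          rw [norm_smul, norm_smul, hνn, mul_one, Real.norm_of_nonneg hε.le, Real.norm_of_nonneg hτ.1.le]
      _ ≤ ε + τ₂ * ‖u‖ := by gcongr
      _ ≤ ρ := by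
          rw [hτ₂, div_mul_eq_mul_div, add_comm, ← le_sub_iff_add_le, div_le_iff₀ (by positivity)]
          nlinarith [norm_nonneg u, hερ]
  -- (iii) `Bad` is null
  have hBad0 : (volume : Measure (EuclideanSpace ℝ d)).toSphere Bad = 0 :=
    measure_mono_null hcover (measure_union_null hX0 (measure_iUnion_null hA0))
  rw [measure_eq_zero_iff_ae_notMem] at hBad0
  filter_upwards [hBad0] with ν hν hout hD
  by_contra hP
  exact hν ⟨hout, hD, hP⟩


/-- **The flux form of Alexander's theorem** (the boundary map of the special flow is
well defined flux-almost everywhere, CIP 1994 App. 4.A; BGSR 2016 p. 15). On `T^d`, `d ≥ 2`,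
`0 < ε < 1/2`, `s` spheres and a label `i`: for Lebesgue-almost every configuration `Z'`, almost
every velocity `w` and `σ`-almost every impact direction `ν` with `⟪w - v_i, ν⟫ > 0` (outgoing),
if the configuration `lossConfig Z' i ν w` obtained by adjoining a sphere at `x_i + ε ν` with
velocity `w` belongs to the hard-sphere domain, then it is a good point of the `(s+1)`-sphere
flow (`Alexander.good`): `ae_lossConfig_of_persistent` with `T` the pathological set of the
domain (null by `Alexander.torusFlow_ae_good_holds`) and persistence by
`Alexander.mem_good_of_freeFlight_mem_good`. [cite: CIP1994, App. 4.A pp. 108–111] -/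
theorem ae_lossConfig_mem_good [DecidableEq d] (hd : 2 ≤ Fintype.card d) {ε : ℝ} (hε : 0 < ε) (hε' : ε < 2⁻¹) {s : ℕ} (i : Fin s) :
    ∀ᵐ Z' : Config s d (UnitAddTorus d), ∀ᵐ w : EuclideanSpace ℝ d,
      ∀ᵐ ν : sphere (0 : EuclideanSpace ℝ d) 1 ∂(volume : Measure (EuclideanSpace ℝ d)).toSphere,
        0 < ⟪w - (Z' i).2, (ν : EuclideanSpace ℝ d)⟫_ℝ →
        lossConfig (Torus.geometry d) ε Z' i ν w ∈ hardSphereDomain (Torus.geometry d) (s + 1) ε →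
        lossConfig (Torus.geometry d) ε Z' i ν w ∈ Alexander.good (N := s + 1) (Torus.geometry d) ε := by
  set G := Torus.geometry d with hG
  set Φ := Alexander.regHardSphereFlow (d := d) hε hε' (s + 1) with hΦ
  set T : Set (Config (s + 1) d (UnitAddTorus d)) :=
    hardSphereDomain G (s + 1) ε ∩ (Alexander.good (N := s + 1) G ε)ᶜ with hT
  have hgoodm : MeasurableSet (Alexander.good (N := s + 1) G ε) := Φ.measurableSet_good
  have hTm : MeasurableSet T :=
    (measurableSet_hardSphereDomain G Torus.measurable_geometry_sepVec (s + 1) ε).inter hgoodm.compl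
  have hT0 : volume T = 0 := by
    have h : liouville G (s + 1) ε (Alexander.good (N := s + 1) G ε)ᶜ = 0 :=
      Alexander.torusFlow_ae_good_holds (d := d) hε hε' (s + 1)
    rw [liouville, Measure.restrict_apply hgoodm.compl] at h
    rw [hT, inter_comm]
    exact h
  refine ae_lossConfig_of_persistent hd hε hε' i hTm hT0 (fun W => W ∈ Alexander.good (N := s + 1) G ε)
    (fun W₀ τ hτ0 _ hwin hbad => ⟨fun j k hjk => (hwin τ ⟨hτ0, le_rfl⟩ j k hjk).le, fun hgood => hbad ?_⟩)
  exact Alexander.mem_good_of_freeFlight_mem_good hε hε' hτ0.le (fun u hu j k hjk => (hwin u hu j k hjk).ne') hgood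

end Kinetic

end

end Literature.Analysis.FluidPDE
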